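import Literature.LinearAlgebra.Matrix.TausskyZassenhausSymmetrizer
import Literature.LinearAlgebra.Matrix.QInversiveSemisimple
import Literature.LinearAlgebra.Matrix.QInversiveEigenvalueBound
import HarnessLib

/-!
# Goresky–Tai 2017, Corollary 39 in full: a semisimple `A₀` (no eigenvalue `±√q`) completes to a semisimple
# `q`-inversive `γ₀ = (A₀ B₀; C₀ ᵗA₀) ∈ GSp_{2n}`; over `ℚ ⊂ ℂ` with `|β_r| < √q` its eigenvalues are Weil `q`-numbers

Topic `Literature/LinearAlgebra/Matrix`; THEOREMS ONLY (no definition, no instance, no named fact; D-0026 net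
debt 0).  Lane `lit-hodgefound` (summit `HodgeConjecture`, Track 2 foundations library), seat
`lit-hodgefound-p15`, generation 56, row g56-#11: the capstone of rows #4 (`QInversiveCompanion`: the completion
`B₀ = S`, `C₀ = S⁻¹(A₀² − qI)` from a symmetriser), #5 (`TausskyZassenhausSymmetrizer`: a symmetriser exists for
every `A₀` — Cor. 39 «in GSp, q-inversive relations» for every `A₀`), #7 (`QInversiveEigenvalueBound`: Weil
eigenvalues) and #8 (`QInversiveSemisimple`: `A` semisimple with `B, C` nonsingular ⟹ `γ` semisimple).

THE PRINT.  M. Goresky, Y.-S. Tai, *Real structures on ordinary Abelian varieties*, arXiv:1701.07742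
[GoreskyTai2017RealStructuresOrdinary], App. §16.2 (p0038), verbatim:

> Corollary 39. Let `A₀ ∈ GL_n(ℚ)` be semisimple and suppose that its characteristic polynomial is an
> ordinary Weil `q`-polynomial. Then there exist `B₀, C₀` so that the matrix `γ₀ = (A₀ B₀; C₀ ᵗA₀)` is in
> `GSp_{2n}(ℚ)` and is `q`-inversive and semisimple.
> *Proof.* The matrix `A₀` is `GL_n(ℚ)`-conjugate to some block diagonal matrix `A = Diag(A₁^{×m₁}, ⋯, A_r^{×m_r})`
> as above, where each `Aᵢ` is a semisimple companion matrix … The above procedure produces a `q`-inversive matrix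
> `γ = (A B; C ᵗA)`. Then `γ₀ = UγU⁻¹` has the desired properties …

and Lemma 12's converse (§4.1, p0011): «let `A ∈ GL_n(ℚ)` be semisimple and suppose that its eigenvalues … are
totally real and that `|β_r| < √q` … Then … `γ` … is `q`-inversive and its eigenvalues … are Weil `q`-numbers.»

WHAT IS HERE.  The route is not the printed block-companion conjugation but the symmetriser `S` of
Taussky–Zassenhaus (row #5): `B₀ = S`, `C₀ = S⁻¹(A₀² − qI)`; `B₀` is always nonsingular and `C₀` is nonsingular
iff `det(A₀² − qI) ≠ 0`, i.e. iff `±√q` is not an eigenvalue of `A₀` — which is exactly what Lemma 12 (1) ⟺ (2)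
requires of a `q`-inversive `γ₀` with nonsingular blocks, and holds under the printed hypotheses (the real
counterpart of an ordinary Weil `q`-polynomial has no root `±2√q`, resp. `|β_r| < √q`).
* §1 `aeval_conj`, **`isSemisimple_toLin'_conj_iff`** (semisimplicity is a conjugation invariant),
  `isSemisimple_toLin'_levi_conj_iff`, `isSemisimple_levi_transport` (the printed transport `γ₀ = UγU⁻¹`).
* §2 `isSemisimple_completion` (any symmetriser), **`exists_qInversive_semisimple_completion`** (perfect field, `2 ≠ 0`, `q ≠ 0`): `A₀` semisimple with
  `det(A₀² − qI) ≠ 0` ⟹ ∃ `B₀, C₀` symmetric NONSINGULAR with the `q`-inversive relations, multiplier `q`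
  (`ᵗγ₀Jγ₀ = qJ`) and `γ₀` SEMISIMPLE.
* **`exists_qInversive_semisimple_weil_completion`** (over `ℂ`, `q > 0` real; the printed `ℚ ⊂ ℝ ⊂ ℂ` reading):
  `A₀` semisimple with every eigenvalue real and `β² < q` ⟹ the same, and moreover every eigenvalue `α` of `γ₀`
  satisfies `|α|² = q`, `α ∉ ℝ` (a Weil `q`-number with no real conjugate).

NOT here: «its characteristic polynomial is an ordinary Weil q-polynomial» as a hypothesis on `p_{A₀}` — the
`p`-adic notion «ordinary» (Prop. 36 (3), Howe ∕ Deligne) is not in the tree; the operative consequence (no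
eigenvalue `±√q`, resp. `|β_r| < √q`) is taken as the hypothesis.

## References
* [GoreskyTai2017RealStructuresOrdinary] M. Goresky, Y.-S. Tai, Real structures on ordinary Abelian varieties,
  arXiv:1701.07742 (2017), App. §16.2 Corollary 39 (p0038); §4.1 Lemma 12, converse (p0011).
-/

open Matrix Polynomial

namespace Literature.LinearAlgebra.Matrix.QInversiveSemisimpleCompletion

variable {K : Type*} [Field K] {n : Type*} [Fintype n] [DecidableEq n]

/-! ## §1 Semisimplicity is a conjugation invariant (the transport `γ₀ = UγU⁻¹` of the printed proof) -/

/-- `(PAP⁻¹)ᵏ = PAᵏP⁻¹`. [folklore] -/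
private theorem conj_pow {P : Matrix n n K} (hP : IsUnit P.det) (A : Matrix n n K) (k : ℕ) :
    (P * A * P⁻¹) ^ k = P * A ^ k * P⁻¹ := by
  induction k with
  | zero => rw [pow_zero, pow_zero, Matrix.mul_one, Matrix.mul_nonsing_inv _ hP]
  | succ k ih =>
    rw [pow_succ, ih, pow_succ, Matrix.mul_assoc (P * A ^ k) P⁻¹, ← Matrix.mul_assoc P⁻¹, ← Matrix.mul_assoc P⁻¹,
      Matrix.nonsing_inv_mul _ hP, Matrix.one_mul, ← Matrix.mul_assoc, ← Matrix.mul_assoc]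

/-- `p(PAP⁻¹) = P·p(A)·P⁻¹`. [cite: GoreskyTai2017RealStructuresOrdinary, App. §16.2 proof of Cor. 39 «γ₀ = UγU⁻¹ has the desired properties» (p0038)] -/
theorem aeval_conj {P : Matrix n n K} (hP : IsUnit P.det) (A : Matrix n n K) (p : K[X]) :
    aeval (P * A * P⁻¹) p = P * aeval A p * P⁻¹ := by
  refine Polynomial.induction_on' p (fun p q hp hq => ?_) (fun k a => ?_)
  · rw [map_add, map_add, hp, hq, Matrix.mul_add, Matrix.add_mul]
  · simp only [aeval_monomial, Algebra.algebraMap_eq_smul_one, smul_mul_assoc, one_mul, conj_pow hP,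
      Matrix.mul_smul]

/-- **Semisimplicity is invariant under conjugation** `A ↦ PAP⁻¹`.
[cite: GoreskyTai2017RealStructuresOrdinary, App. §16.2 proof of Cor. 39 «γ₀ = UγU⁻¹ has the desired properties» (p0038)] -/
theorem isSemisimple_toLin'_conj_iff {P : Matrix n n K} (hP : IsUnit P.det) (A : Matrix n n K) :
    Module.End.IsSemisimple (Matrix.toLin' (P * A * P⁻¹)) ↔ Module.End.IsSemisimple (Matrix.toLin' A) := by
  rw [QInversiveSemisimple.isSemisimple_toLin'_iff, QInversiveSemisimple.isSemisimple_toLin'_iff]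
  refine exists_congr fun s => and_congr_right fun _ => ?_
  rw [aeval_conj hP]
  constructor
  · intro h
    have h' := congrArg (fun M => P⁻¹ * M * P) h
    simp only [Matrix.mul_zero, Matrix.zero_mul] at h'
    rwa [← Matrix.mul_assoc, ← Matrix.mul_assoc, Matrix.nonsing_inv_mul _ hP, Matrix.one_mul, Matrix.mul_assoc,
      Matrix.nonsing_inv_mul _ hP, Matrix.mul_one] at h'
  · intro h
    rw [h, Matrix.mul_zero, Matrix.zero_mul]

/-- The Levi transport `γ ↦ UγU⁻¹`, `U = diag(u, ᵗu⁻¹) ∈ Sp_{2n}`, preserves semisimplicity.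
[cite: GoreskyTai2017RealStructuresOrdinary, App. §16.2 proof of Cor. 39 «U = (u 0; 0 ᵗu⁻¹) ∈ Sp_2n(ℚ)» (p0038)] -/
theorem isSemisimple_toLin'_levi_conj_iff {m : Type*} [Fintype m] [DecidableEq m] {u : Matrix m m K}
    (hu : IsUnit u.det) (γ : Matrix (m ⊕ m) (m ⊕ m) K) :
    Module.End.IsSemisimple (Matrix.toLin' (Sp.levi u * γ * Sp.levi u⁻¹)) ↔
      Module.End.IsSemisimple (Matrix.toLin' γ) := by
  have h1 : Sp.levi u * Sp.levi u⁻¹ = 1 := by rw [Sp.levi_mul_levi, Matrix.mul_nonsing_inv _ hu, Sp.levi_one]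
  have hU : IsUnit (Sp.levi u).det := Matrix.isUnit_det_of_right_inverse h1
  have hinv : Sp.levi u⁻¹ = (Sp.levi u)⁻¹ := (Matrix.inv_eq_right_inv h1).symm
  rw [hinv]
  exact isSemisimple_toLin'_conj_iff hU γ

/-- **The printed route of Cor. 39**: if `A₀ = uAu⁻¹` and `γ = (A B; C ᵗA)` is semisimple then so is the
transported `γ₀ = UγU⁻¹ = (A₀, uBᵗu; ᵗu⁻¹Cu⁻¹, ᵗA₀)` (its `q`-inversive relations:
`QInversiveCompanion.relations_levi_conj`). [cite: GoreskyTai2017RealStructuresOrdinary, App. §16.2 proof of Cor. 39 (p0038)] -/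
theorem isSemisimple_levi_transport {m : Type*} [Fintype m] [DecidableEq m] {u : Matrix m m K} (hu : IsUnit u.det)
    {A B C : Matrix m m K} (hγ : Module.End.IsSemisimple (Matrix.toLin' (fromBlocks A B C Aᵀ))) :
    Module.End.IsSemisimple
      (Matrix.toLin' (fromBlocks (u * A * u⁻¹) (u * B * uᵀ) (u⁻¹ᵀ * C * u⁻¹) (u * A * u⁻¹)ᵀ)) := by
  rw [← QInversiveCompanion.levi_conj_fromBlocks hu, isSemisimple_toLin'_levi_conj_iff hu]
  exact hγ

/-! ## §2 Corollary 39 with semisimplicity, from a symmetriser -/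

/-- For ANY symmetriser `S` of a semisimple `A₀` (`S` symmetric nonsingular, `A₀S = SᵗA₀`) and `det(A₀² − qI) ≠ 0`:
the completion `(A₀, S; S⁻¹(A₀² − qI), ᵗA₀)` is semisimple (perfect field, `2 ≠ 0`, `q ≠ 0`).
[cite: GoreskyTai2017RealStructuresOrdinary, App. §16.2 Corollary 39 (p0038); §4.1 Lemma 12, converse (4.4) (p0011)] -/
theorem isSemisimple_completion [PerfectField K] (h2 : (2 : K) ≠ 0) {A₀ S : Matrix n n K} {q : K} (hq0 : q ≠ 0)
    (hS : Sᵀ = S) (hSu : IsUnit S.det) (hAS : A₀ * S = S * A₀ᵀ) (hA₀ : Module.End.IsSemisimple (Matrix.toLin' A₀))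
    (hdet : (A₀ * A₀ - q • (1 : Matrix n n K)).det ≠ 0) :
    Module.End.IsSemisimple (Matrix.toLin' (fromBlocks A₀ S (S⁻¹ * (A₀ * A₀ - q • (1 : Matrix n n K))) A₀ᵀ)) := by
  obtain ⟨hC, hAB, hCA, hq⟩ := QInversiveCompanion.completion_relations hS hSu hAS q
  refine QInversiveSemisimple.isSemisimple_of_isSemisimple_A h2 hq0 hS hC hAB hCA hq hA₀ hSu.ne_zero ?_
  rw [det_mul]
  exact mul_ne_zero (Matrix.isUnit_nonsing_inv_det_iff.mpr hSu).ne_zero hdet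

/-- **COROLLARY 39 with semisimplicity** (perfect field with `2 ≠ 0`, `q ≠ 0`): a semisimple `A₀` without the
eigenvalues `±√q` (`det(A₀² − qI) ≠ 0`) is the upper-left block of a SEMISIMPLE `q`-inversive
`γ₀ = (A₀ B₀; C₀ ᵗA₀)` with multiplier `q`, `B₀, C₀` symmetric and nonsingular.
[cite: GoreskyTai2017RealStructuresOrdinary, App. §16.2 Corollary 39 «there exist B₀, C₀ so that the matrix γ₀ … is in GSp_2n(ℚ) and is q-inversive and semisimple» (p0038)] -/
theorem exists_qInversive_semisimple_completion [PerfectField K] (h2 : (2 : K) ≠ 0) (A₀ : Matrix n n K) {q : K}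
    (hq0 : q ≠ 0) (hA₀ : Module.End.IsSemisimple (Matrix.toLin' A₀))
    (hdet : (A₀ * A₀ - q • (1 : Matrix n n K)).det ≠ 0) :
    ∃ B₀ C₀ : Matrix n n K, B₀ᵀ = B₀ ∧ C₀ᵀ = C₀ ∧ A₀ * B₀ = B₀ * A₀ᵀ ∧ C₀ * A₀ = A₀ᵀ * C₀ ∧
      A₀ * A₀ - B₀ * C₀ = q • (1 : Matrix n n K) ∧ B₀.det ≠ 0 ∧ C₀.det ≠ 0 ∧
      (fromBlocks A₀ B₀ C₀ A₀ᵀ)ᵀ * J n K * fromBlocks A₀ B₀ C₀ A₀ᵀ = q • J n K ∧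
      Module.End.IsSemisimple (Matrix.toLin' (fromBlocks A₀ B₀ C₀ A₀ᵀ)) := by
  obtain ⟨S, hS, hSu, hAS⟩ := TausskyZassenhausSymmetrizer.exists_symmetrizer A₀
  obtain ⟨hC, hAB, hCA, hq⟩ := QInversiveCompanion.completion_relations hS hSu hAS q
  have hBd : S.det ≠ 0 := hSu.ne_zero
  have hCd : (S⁻¹ * (A₀ * A₀ - q • (1 : Matrix n n K))).det ≠ 0 := by
    rw [det_mul]
    exact mul_ne_zero (Matrix.isUnit_nonsing_inv_det_iff.mpr hSu).ne_zero hdet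
  exact ⟨S, S⁻¹ * (A₀ * A₀ - q • 1), hS, hC, hAB, hCA, hq, hBd, hCd,
    QInversiveCompanion.completion_multiplier hS hSu hAS q,
    QInversiveSemisimple.isSemisimple_of_isSemisimple_A h2 hq0 hS hC hAB hCA hq hA₀ hBd hCd⟩

/-- **COROLLARY 39 over `ℚ ⊂ ℂ`, with Lemma 12's converse**: `A₀ ∈ M_n(ℂ)` semisimple with all eigenvalues real
and `β² < q` (`q > 0`; the printed `|β_r| < √q`) is the upper-left block of a semisimple `q`-inversive `γ₀` with
multiplier `q` whose eigenvalues `α` are Weil `q`-numbers with no real one: `|α|² = q`, `Im α ≠ 0`.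
[cite: GoreskyTai2017RealStructuresOrdinary, App. §16.2 Corollary 39 (p0038); §4.1 Lemma 12 «is q-inversive and its eigenvalues α_r = β_r ± √(β_r² − q) are Weil q-numbers» (p0011)] -/
theorem exists_qInversive_semisimple_weil_completion (A₀ : Matrix n n ℂ) {q : ℝ} (hq0 : 0 < q)
    (hA₀ : Module.End.IsSemisimple (Matrix.toLin' A₀))
    (heig : ∀ β ∈ A₀.charpoly.roots, β.im = 0 ∧ β.re ^ 2 < q) :
    ∃ B₀ C₀ : Matrix n n ℂ, B₀ᵀ = B₀ ∧ C₀ᵀ = C₀ ∧ A₀ * B₀ = B₀ * A₀ᵀ ∧ C₀ * A₀ = A₀ᵀ * C₀ ∧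
      A₀ * A₀ - B₀ * C₀ = (q : ℂ) • (1 : Matrix n n ℂ) ∧ B₀.det ≠ 0 ∧ C₀.det ≠ 0 ∧
      (fromBlocks A₀ B₀ C₀ A₀ᵀ)ᵀ * J n ℂ * fromBlocks A₀ B₀ C₀ A₀ᵀ = (q : ℂ) • J n ℂ ∧
      Module.End.IsSemisimple (Matrix.toLin' (fromBlocks A₀ B₀ C₀ A₀ᵀ)) ∧
      ∀ α ∈ (fromBlocks A₀ B₀ C₀ A₀ᵀ).charpoly.roots, Complex.normSq α = q ∧ α.im ≠ 0 := by
  obtain ⟨B₀, C₀, hB, hC, hAB, hCA, hq, hBd, hCd, hmul, hss⟩ :=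
    exists_qInversive_semisimple_completion two_ne_zero A₀ (Complex.ofReal_ne_zero.mpr hq0.ne') hA₀
      (QInversiveSemisimple.det_mul_self_sub_ne_zero_of_eigenvalues hq0 fun β hβ => (heig β hβ).2)
  exact ⟨B₀, C₀, hB, hC, hAB, hCA, hq, hBd, hCd, hmul, hss,
    QInversiveEigenvalueBound.weil_no_real_roots_of_eigenvalues hq0 hB hC hAB hCA hq heig⟩

end Literature.LinearAlgebra.Matrix.QInversiveSemisimpleCompletion
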